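import Mathlib
import HarnessLib

/-!
# Local spreading: uniform ball bounds, thin points, thickening gains a ball, and the local Tonelli identity

HONEST FRAMING: exact (Metropolis-corrected) sampling algorithms for lattice gauge theory;
figures of merit are autocorrelation/cost numbers at stated couplings and volumes; no
continuum-physics claim.

Venture `LatticeQCDFlow` (cell pub-lqcd), topic `Exactness`, FANOUT row 9 (eng-latcore; the lemmas of
`SpreadingKernelDoeblin.lean` — a locally spreading exact update interleaved with ANY exact step keeps a
Doeblin power on a compact connected space: the engine's `update + n_or × over-relaxation` composites).
NEW WORK of the cell over Mathlib only (finite covers by balls, `infDist` and the intermediate value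
theorem on a preconnected space, thickenings, `Measure.prod_apply` / `prod_apply_symm`, the Giry monad);
nothing is cited as a fact; no number is claimed.  `X` is a pseudo-metric space with its Borel sets.

* §1 (compactness) `exists_mem_cover_ball`; **`exists_le_measure_ball`** — a measure charging every ball
  gives all `ρ`-balls a common lower bound `v ≠ 0`; **`exists_coverNumber`** — THIN POINTS ARE FEW: for
  a covering number `N` of the space by `s/2`-balls, EVERY measure `σ` gives the set
  `{w : σ(B(w, s)) < θ}` mass `≤ N θ`.
* §2 (connectedness) `exists_ball_subset_thickening` — if `C ≠ ∅` and its `s/2`-thickening is not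
  everything, a ball of radius `s/2` sits inside the `s`-thickening of `C` and misses `C` (a point at
  distance exactly `s/2`); **`measure_thickening_ge`** — hence `π C + v ≤ π (thickening s C)`.
* §3 `measurableSet_inter_ball_rel`, `measurable_measure_inter_ball`, `measurable_measure_ball`,
  **`lintegral_measure_inter_ball`** — `∫ π(A ∩ B(y, r)) dσ(y) = ∫_{z ∈ A} σ(B(z, r)) dπ(z)`.
* §4 `bind_mono_left`, `bind_kernel_comp`, **`smul_restrict_le_bind`** — THE SPREADING STEP: if
  `K(y, ·) ≥ c · π|_{B(y, r)}` for all `y` and `σ(B(z, r)) ≥ θ` for all `z ∈ D`, then `σ K ≥ (c θ) · π|_D`.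

NOT CLAIMED: anything quantitative (the constants come from compactness).
-/

noncomputable section

namespace Summit.Ventures.LatticeQCDFlow.Exactness

open MeasureTheory Measure Metric Set Filter Topology Function ProbabilityTheory ProbabilityTheory.Kernel
open scoped ENNReal

variable {X : Type*} [PseudoMetricSpace X] [MeasurableSpace X] [BorelSpace X] [SecondCountableTopology X]

/-! ## §1 Balls: a uniform lower bound, and thin points are few (compactness) -/

omit [MeasurableSpace X] [BorelSpace X] [SecondCountableTopology X] in
/-- From a finite cover by `ρ/2`-balls: every point lies in one of them, and that small ball sits inside
the point's `ρ`-ball. -/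
theorem exists_mem_cover_ball [CompactSpace X] {ρ : ℝ} (hρ : 0 < ρ) :
    ∃ t : Finset X, ∀ x, ∃ p ∈ t, ball p (ρ / 2) ⊆ ball x ρ ∧ x ∈ ball p (ρ / 2) := by
  obtain ⟨t, -, htfin, hcover⟩ := finite_cover_balls_of_compact (isCompact_univ (X := X)) (half_pos hρ)
  refine ⟨htfin.toFinset, fun x => ?_⟩
  obtain ⟨p, hp, hxp⟩ : ∃ p ∈ t, x ∈ ball p (ρ / 2) := by
    have hx := hcover (mem_univ x)
    simpa only [mem_iUnion, exists_prop] using hx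
  refine ⟨p, htfin.mem_toFinset.2 hp, fun y hy => ?_, hxp⟩
  rw [mem_ball] at hy hxp ⊢
  calc dist y x ≤ dist y p + dist x p := dist_triangle_right _ _ _
    _ < ρ / 2 + ρ / 2 := add_lt_add hy hxp
    _ = ρ := add_halves ρ

omit [BorelSpace X] [SecondCountableTopology X] in
/-- **Uniform lower bound for balls.**  On a compact space, a measure charging every open ball gives
all balls of one radius a common lower bound `v ≠ 0`. -/
theorem exists_le_measure_ball [CompactSpace X] (π : Measure X)
    (hpos : ∀ (x : X) (ρ : ℝ), 0 < ρ → π (ball x ρ) ≠ 0) {ρ : ℝ} (hρ : 0 < ρ) :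
    ∃ v : ℝ≥0∞, v ≠ 0 ∧ ∀ x, v ≤ π (ball x ρ) := by
  obtain ⟨t, ht⟩ := exists_mem_cover_ball (X := X) hρ
  rcases t.eq_empty_or_nonempty with h0 | hne
  · refine ⟨1, one_ne_zero, fun x => ?_⟩
    obtain ⟨p, hp, -⟩ := ht x
    rw [h0] at hp
    simp at hp
  · obtain ⟨p₀, hp₀, hmin⟩ := Finset.exists_mem_eq_inf' hne (fun p => π (ball p (ρ / 2)))
    refine ⟨t.inf' hne (fun p => π (ball p (ρ / 2))), ?_, fun x => ?_⟩
    · rw [hmin]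
      exact hpos p₀ _ (half_pos hρ)
    · obtain ⟨p, hp, hsub, -⟩ := ht x
      exact (Finset.inf'_le _ hp).trans (measure_mono hsub)

omit [BorelSpace X] [SecondCountableTopology X] in
/-- **Thin points are few.**  There is a covering number `N` (of the compact space by `s/2`-balls) such
that for EVERY measure `σ` and every level `θ` the set of points whose `s`-ball carries `σ`-mass `< θ`
has `σ`-mass at most `N θ`. -/
theorem exists_coverNumber [CompactSpace X] {s : ℝ} (hs : 0 < s) :
    ∃ N : ℕ, ∀ (σ : Measure X) (θ : ℝ≥0∞), σ {w | σ (ball w s) < θ} ≤ N * θ := by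
  obtain ⟨t, ht⟩ := exists_mem_cover_ball (X := X) hs
  refine ⟨t.card, fun σ θ => ?_⟩
  set T : Set X := {w | σ (ball w s) < θ}
  have hsub : T ⊆ ⋃ p ∈ t, (T ∩ ball p (s / 2)) := by
    intro w hw
    obtain ⟨p, hp, -, hwp⟩ := ht w
    exact mem_biUnion hp ⟨hw, hwp⟩
  have hterm : ∀ p ∈ t, σ (T ∩ ball p (s / 2)) ≤ θ := by
    intro p _
    rcases (T ∩ ball p (s / 2)).eq_empty_or_nonempty with h0 | ⟨w, hwT, hwp⟩
    · rw [h0, measure_empty]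
      exact zero_le
    · calc σ (T ∩ ball p (s / 2)) ≤ σ (ball w s) := by
            refine measure_mono fun y hy => ?_
            have hy' := mem_ball.1 hy.2
            rw [mem_ball] at hwp ⊢
            calc dist y w ≤ dist y p + dist w p := dist_triangle_right _ _ _
              _ < s / 2 + s / 2 := add_lt_add hy' hwp
              _ = s := add_halves s
        _ ≤ θ := le_of_lt hwT
  calc σ T ≤ σ (⋃ p ∈ t, (T ∩ ball p (s / 2))) := measure_mono hsub
    _ ≤ ∑ p ∈ t, σ (T ∩ ball p (s / 2)) := measure_biUnion_finset_le _ _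
    _ ≤ ∑ p ∈ t, θ := Finset.sum_le_sum hterm
    _ = t.card * θ := by rw [Finset.sum_const, nsmul_eq_mul]

/-! ## §2 Connectedness: thickening a set gains a ball -/

omit [MeasurableSpace X] [BorelSpace X] [SecondCountableTopology X] in
/-- **A point at distance exactly `s/2`.**  In a preconnected space, if `C` is nonempty and its
`s/2`-thickening is not everything, some ball of radius `s/2` lies inside the `s`-thickening of `C` and
misses `C` (the distance to `C` is continuous, vanishes on `C` and is `≥ s/2` somewhere). -/
theorem exists_ball_subset_thickening [PreconnectedSpace X] {C : Set X} (hC : C.Nonempty) {s : ℝ}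
    (hs : 0 < s) (hne : thickening (s / 2) C ≠ univ) :
    ∃ p, ball p (s / 2) ⊆ thickening s C ∧ Disjoint (ball p (s / 2)) C := by
  obtain ⟨c₀, hc₀⟩ := hC
  obtain ⟨q, hq⟩ := (ne_univ_iff_exists_notMem _).1 hne
  have hq' : s / 2 ≤ infDist q C := by
    by_contra h
    exact hq ((mem_thickening_iff_infDist_lt ⟨c₀, hc₀⟩).2 (not_le.1 h))
  obtain ⟨p, hp⟩ : s / 2 ∈ range fun x => infDist x C :=
    intermediate_value_univ c₀ q (continuous_infDist_pt C)
      ⟨by rw [infDist_zero_of_mem hc₀]; exact (half_pos hs).le, hq'⟩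
  simp only at hp
  refine ⟨p, fun y hy => ?_, disjoint_left.2 fun y hy hyC => ?_⟩
  · rw [mem_ball] at hy
    rw [mem_thickening_iff_infDist_lt ⟨c₀, hc₀⟩]
    calc infDist y C ≤ infDist p C + dist y p := infDist_le_infDist_add_dist
      _ < s / 2 + s / 2 := by rw [hp]; exact add_lt_add_right hy _
      _ = s := add_halves s
  · rw [mem_ball] at hy
    have h1 : infDist p C ≤ infDist y C + dist p y := infDist_le_infDist_add_dist
    rw [infDist_zero_of_mem hyC, zero_add, dist_comm, hp] at h1
    exact absurd hy (not_lt.2 h1)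

omit [SecondCountableTopology X] in
/-- **Thickening gains measure.**  With `v` a lower bound for the measure of `s/2`-balls: if `C` is
nonempty and its `s/2`-thickening is not everything, then `π C + v ≤ π (thickening s C)`. -/
theorem measure_thickening_ge [PreconnectedSpace X] (π : Measure X) {v : ℝ≥0∞} {s : ℝ} (hs : 0 < s)
    (hv : ∀ x, v ≤ π (ball x (s / 2))) {C : Set X} (hC : C.Nonempty) (hne : thickening (s / 2) C ≠ univ) :
    π C + v ≤ π (thickening s C) := by
  obtain ⟨p, hsub, hdisj⟩ := exists_ball_subset_thickening hC hs hne
  calc π C + v ≤ π C + π (ball p (s / 2)) := add_le_add_right (hv p) _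
    _ = π (C ∪ ball p (s / 2)) := (measure_union hdisj.symm measurableSet_ball).symm
    _ ≤ π (thickening s C) := measure_mono (union_subset (self_subset_thickening hs C) hsub)

/-! ## §3 The local Tonelli identity -/

/-- The relation "`q.2 ∈ A` and `q.2` lies in the `r`-ball of `q.1`" is a measurable subset of `X × X`. -/
theorem measurableSet_inter_ball_rel {A : Set X} (hA : MeasurableSet A) (r : ℝ) :
    MeasurableSet {q : X × X | q.2 ∈ A ∧ dist q.2 q.1 < r} :=
  (measurable_snd hA).inter (measurableSet_lt (continuous_snd.dist continuous_fst).measurable measurable_const)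

/-- `y ↦ π (A ∩ B(y, r))` is measurable (sections of a measurable relation). -/
theorem measurable_measure_inter_ball (π : Measure X) [SFinite π] {A : Set X} (hA : MeasurableSet A)
    (r : ℝ) : Measurable fun y => π (A ∩ ball y r) :=
  measurable_measure_prodMk_left (measurableSet_inter_ball_rel hA r)

/-- `y ↦ σ (B(y, r))` is measurable. -/
theorem measurable_measure_ball (σ : Measure X) [SFinite σ] (r : ℝ) : Measurable fun y => σ (ball y r) := by
  have h := measurable_measure_inter_ball σ MeasurableSet.univ r
  simpa only [univ_inter] using h

/-- **The local Tonelli identity**: `∫ π(A ∩ B(y, r)) dσ(y) = ∫_{z ∈ A} σ(B(z, r)) dπ(z)` — both are the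
`σ ⊗ π`-measure of `{(y, z) : z ∈ A, dist z y < r}`, and the ball relation is symmetric. -/
theorem lintegral_measure_inter_ball (σ π : Measure X) [SFinite σ] [SFinite π] {A : Set X}
    (hA : MeasurableSet A) (r : ℝ) :
    ∫⁻ y, π (A ∩ ball y r) ∂σ = ∫⁻ z in A, σ (ball z r) ∂π := by
  have hS := measurableSet_inter_ball_rel (X := X) hA r
  have h2 : ∀ z, σ ((fun y => (y, z)) ⁻¹' {q : X × X | q.2 ∈ A ∧ dist q.2 q.1 < r}) =
      A.indicator (fun z => σ (ball z r)) z := by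
    intro z
    by_cases hz : z ∈ A
    · rw [indicator_of_mem hz]
      congr 1
      ext y
      simp only [mem_preimage, mem_setOf_eq, mem_ball]
      rw [dist_comm]
      exact ⟨fun h => h.2, fun h => ⟨hz, h⟩⟩
    · rw [indicator_of_notMem hz]
      have : (fun y => (y, z)) ⁻¹' {q : X × X | q.2 ∈ A ∧ dist q.2 q.1 < r} = ∅ := by
        ext y
        simp only [mem_preimage, mem_setOf_eq, mem_empty_iff_false, iff_false, not_and]
        exact fun h => absurd h hz
      rw [this, measure_empty]
  calc ∫⁻ y, π (A ∩ ball y r) ∂σ = ∫⁻ y, π (Prod.mk y ⁻¹' {q : X × X | q.2 ∈ A ∧ dist q.2 q.1 < r}) ∂σ := rfl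
    _ = (σ.prod π) {q : X × X | q.2 ∈ A ∧ dist q.2 q.1 < r} := (Measure.prod_apply hS).symm
    _ = ∫⁻ z, σ ((fun y => (y, z)) ⁻¹' {q : X × X | q.2 ∈ A ∧ dist q.2 q.1 < r}) ∂π :=
        Measure.prod_apply_symm hS
    _ = ∫⁻ z, A.indicator (fun z => σ (ball z r)) z ∂π := lintegral_congr h2
    _ = ∫⁻ z in A, σ (ball z r) ∂π := lintegral_indicator hA _

/-! ## §4 The spreading step -/

omit [PseudoMetricSpace X] [BorelSpace X] [SecondCountableTopology X] in
/-- Binding is monotone in the measure. -/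
theorem bind_mono_left {μ μ' : Measure X} (h : μ ≤ μ') (κ : Kernel X X) : μ.bind κ ≤ μ'.bind κ := by
  refine Measure.le_iff.2 fun E hE => ?_
  rw [Measure.bind_apply hE (Kernel.aemeasurable κ), Measure.bind_apply hE (Kernel.aemeasurable κ)]
  exact lintegral_mono' h le_rfl

omit [PseudoMetricSpace X] [BorelSpace X] [SecondCountableTopology X] in
/-- Binding with a composite kernel is binding twice: `μ (η ∘ₖ κ) = (μ κ) η`. -/
theorem bind_kernel_comp (μ : Measure X) (κ η : Kernel X X) : μ.bind (η ∘ₖ κ) = (μ.bind κ).bind η :=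
  (Measure.comp_assoc (μ := μ) (κ := κ) (η := η)).symm

/-- **THE SPREADING STEP.**  If `K(y, ·) ≥ c · π|_{B(y, r)}` for every `y`, and a measure `σ` gives
mass `≥ θ` to the `r`-ball of every point of a measurable set `D`, then `σ K ≥ (c θ) · π|_D`:
`(σK)(E) ≥ c ∫ π(E ∩ B(y, r)) dσ(y) = c ∫_E σ(B(z, r)) dπ(z) ≥ c θ π(E ∩ D)`. -/
theorem smul_restrict_le_bind (π : Measure X) [SFinite π] {K : Kernel X X} {c : ℝ≥0∞} {r : ℝ}
    (hK : ∀ y, c • π.restrict (ball y r) ≤ K y) (σ : Measure X) [SFinite σ] {D : Set X}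
    (hD : MeasurableSet D) {θ : ℝ≥0∞} (hθ : ∀ z ∈ D, θ ≤ σ (ball z r)) :
    (c * θ) • π.restrict D ≤ σ.bind K := by
  refine Measure.le_iff.2 fun E hE => ?_
  rw [Measure.smul_apply, Measure.restrict_apply hE, smul_eq_mul,
    Measure.bind_apply hE (Kernel.aemeasurable K)]
  calc c * θ * π (E ∩ D) = c * (θ * π (E ∩ D)) := mul_assoc _ _ _
    _ = c * ∫⁻ _ in E ∩ D, θ ∂π := by rw [MeasureTheory.setLIntegral_const]
    _ ≤ c * ∫⁻ z in E ∩ D, σ (ball z r) ∂π :=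
        mul_le_mul' le_rfl (setLIntegral_mono' (hE.inter hD) fun z hz => hθ z hz.2)
    _ ≤ c * ∫⁻ z in E, σ (ball z r) ∂π :=
        mul_le_mul' le_rfl (lintegral_mono' (Measure.restrict_mono inter_subset_left le_rfl) le_rfl)
    _ = c * ∫⁻ y, π (E ∩ ball y r) ∂σ := by rw [lintegral_measure_inter_ball σ π hE r]
    _ = ∫⁻ y, c * π (E ∩ ball y r) ∂σ := (lintegral_const_mul _ (measurable_measure_inter_ball π hE r)).symm
    _ ≤ ∫⁻ y, K y E ∂σ := lintegral_mono fun y => by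
        have h := Measure.le_iff.1 (hK y) E hE
        rwa [Measure.smul_apply, Measure.restrict_apply hE, smul_eq_mul] at h

/-! ## §5 One spreading round: the thick set grows by a fixed amount

(Appended, gen-21.)  The round of the continuity-free Doeblin iteration of
`SpreadingKernelDoeblin.lean` (HOME/eng-latcore/lean-sources/gen21/README.md), stated for a closing exact step
`P'` that may differ from the step `P` that closed the previous round (so that schedules —
`SpreadingKernelSchedules.lean` — and the plain alternation `P ∘ₖ K` are the same lemma).  Mathlib only
(`ProbabilityTheory.Kernel.Invariant`) over §§1–4 above; no number is claimed. -/

section Round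

variable [CompactSpace X] [PreconnectedSpace X] {π : Measure X} [IsFiniteMeasure π]
  {K P : Kernel X X} [IsMarkovKernel P] {c : ℝ≥0∞} {r : ℝ}

/-- **ONE ROUND.**  Data: `K` spreads locally at radius `r` with constant `c`; `P` is Markov and leaves
`π` invariant (the exact step that closed the previous round); `P'` is the exact step closing this round
(any kernel — in applications `P' = P`, or the next member of a schedule); `v ≠ 0, ∞` bounds the
`π`-measure of `r/4`-balls from below; `N` is a covering number for thinness at radius `r/2`; the level `θ`
satisfies `θ ≤ v` and `N θ ≤ v/2`.  If the current law `ν` dominates `a · (π|_A) P` with `b ≤ π A` (`v ≤ b`)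
or `A = univ`, then after one more `K` and then `P'` the law dominates `(a c θ) · (π|_{A'}) P'` with
`b + v/2 ≤ π A'` or `A' = univ` (`A'` = the `r/2`-thickening of the `θ`-thick points of `(π|_A) P`). -/
theorem spreading_round (hP : Invariant P π) (P' : Kernel X X) (hr : 0 < r)
    (hK : ∀ y, c • π.restrict (ball y r) ≤ K y)
    {v : ℝ≥0∞} (hv0 : v ≠ 0) (hvtop : v ≠ ⊤) (hv : ∀ x, v ≤ π (ball x (r / 4)))
    {N : ℕ} (hN : ∀ (σ : Measure X) (θ : ℝ≥0∞), σ {w | σ (ball w (r / 2)) < θ} ≤ N * θ)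
    {θ : ℝ≥0∞} (hθv : θ ≤ v) (hNθ : (N : ℝ≥0∞) * θ ≤ v / 2)
    {A : Set X} {b : ℝ≥0∞} (hb : v ≤ b) (hlo : b ≤ π A ∨ A = univ)
    {ν : Measure X} {a : ℝ≥0∞} (hν : a • (π.restrict A).bind P ≤ ν) :
    ∃ A' : Set X, MeasurableSet A' ∧ (b + v / 2 ≤ π A' ∨ A' = univ) ∧
      (a * (c * θ)) • (π.restrict A').bind P' ≤ (ν.bind K).bind P' := by
  -- the intermediate law `σ = (π|_A) P ≤ π`, of mass `π A`
  set σ : Measure X := (π.restrict A).bind P with hσ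
  have hσle : σ ≤ π := by
    calc σ ≤ π.bind P := bind_mono_left Measure.restrict_le_self P
      _ = π := hP.def
  have hσuniv : σ univ = π A := by
    rw [hσ, Measure.bind_apply MeasurableSet.univ (Kernel.aemeasurable P)]
    simp only [measure_univ, MeasureTheory.lintegral_const, Measure.restrict_apply_univ, one_mul]
  haveI : IsFiniteMeasure σ := ⟨by rw [hσuniv]; exact measure_lt_top π A⟩
  -- the thick points and their thickening
  set C' : Set X := {w | θ ≤ σ (ball w (r / 2))} with hC'
  have hC'm : MeasurableSet C' := measurableSet_le measurable_const (measurable_measure_ball σ (r / 2))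
  set D : Set X := thickening (r / 2) C' with hDdef
  have hDm : MeasurableSet D := isOpen_thickening.measurableSet
  have hθD : ∀ z ∈ D, θ ≤ σ (ball z r) := by
    intro z hz
    obtain ⟨w, hw, hzw⟩ := mem_thickening_iff.1 hz
    calc θ ≤ σ (ball w (r / 2)) := hw
      _ ≤ σ (ball z r) := by
          refine measure_mono fun y hy => ?_
          rw [mem_ball] at hy ⊢
          calc dist y z ≤ dist y w + dist z w := dist_triangle_right _ _ _
            _ < r / 2 + r / 2 := add_lt_add hy hzw
            _ = r := add_halves r
  -- the minorant after `K` then `P`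
  have hmin : (a * (c * θ)) • (π.restrict D).bind P' ≤ (ν.bind K).bind P' := by
    have h1 : (c * θ) • π.restrict D ≤ σ.bind K := smul_restrict_le_bind π hK σ hDm hθD
    have h2 : (a * (c * θ)) • π.restrict D ≤ ν.bind K := by
      calc (a * (c * θ)) • π.restrict D = a • ((c * θ) • π.restrict D) := by rw [smul_smul]
        _ ≤ a • σ.bind K := by
            refine Measure.le_iff'.2 fun E => ?_
            simp only [Measure.smul_apply, smul_eq_mul]
            exact mul_le_mul' le_rfl (Measure.le_iff'.1 h1 E)
        _ = (a • σ).bind K := (Measure.bind_smul a σ _).symm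
        _ ≤ ν.bind K := bind_mono_left hν K
    calc (a * (c * θ)) • (π.restrict D).bind P' = ((a * (c * θ)) • π.restrict D).bind P' :=
          (Measure.bind_smul _ _ _).symm
      _ ≤ (ν.bind K).bind P' := bind_mono_left h2 P'
  refine ⟨D, hDm, ?_, hmin⟩
  -- growth
  have hvhalf_lt : v / 2 < v := ENNReal.half_lt_self hv0 hvtop
  rcases hlo with hbA | hAu
  · by_cases hfull : thickening (r / 4) C' = univ
    · right
      refine eq_univ_of_univ_subset ?_
      rw [← hfull, hDdef]
      exact thickening_mono (by linarith) C'
    · left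
      have hthin : σ C'ᶜ ≤ N * θ := by
        have hc : C'ᶜ = {w | σ (ball w (r / 2)) < θ} := by
          ext w
          simp only [hC', mem_compl_iff, mem_setOf_eq, not_le]
        rw [hc]
        exact hN σ θ
      have hAC : π A ≤ π C' + v / 2 := by
        calc π A = σ univ := hσuniv.symm
          _ ≤ σ C' + σ C'ᶜ := measure_univ_le_add_compl C'
          _ ≤ π C' + N * θ := add_le_add (Measure.le_iff'.1 hσle C') hthin
          _ ≤ π C' + v / 2 := add_le_add_right hNθ _
      have hC'ne : C'.Nonempty := by
        by_contra h0
        rw [not_nonempty_iff_eq_empty] at h0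
        rw [h0, measure_empty, zero_add] at hAC
        exact absurd (hb.trans (hbA.trans hAC)) (not_le.2 hvhalf_lt)
      have hv' : ∀ x, v ≤ π (ball x (r / 2 / 2)) := fun x => by
        rw [div_div, show (2 : ℝ) * 2 = 4 by norm_num]
        exact hv x
      have hne' : thickening (r / 2 / 2) C' ≠ univ := by
        rwa [div_div, show (2 : ℝ) * 2 = 4 by norm_num]
      have hgrow : π C' + v ≤ π D := measure_thickening_ge π (half_pos hr) hv' hC'ne hne'
      calc b + v / 2 ≤ (π C' + v / 2) + v / 2 := add_le_add_left (hbA.trans hAC) _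
        _ = π C' + v := by rw [add_assoc, ENNReal.add_halves]
        _ ≤ π D := hgrow
  · right
    have hσπ : σ = π := by rw [hσ, hAu, Measure.restrict_univ, hP.def]
    have hC'u : C' = univ := by
      refine eq_univ_of_forall fun w => ?_
      show θ ≤ σ (ball w (r / 2))
      rw [hσπ]
      exact hθv.trans ((hv w).trans (measure_mono (ball_subset_ball (by linarith))))
    rw [hDdef, hC'u]
    exact eq_univ_of_univ_subset (self_subset_thickening (half_pos hr) _)

end Round

end Summit.Ventures.LatticeQCDFlow.Exactness
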